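import Mathlib

/-!
# SoloBlind artefact 20 — the Fejér step behind THEOREM K (`paper/window-height.md` §12.10.3(i); claims C73, C69)

Context (soloist `solo-RiemannHypothesis-blind`).  THEOREM K of the report: for every nonnegative trigonometric
polynomial `T` of degree `≤ n`, `∫₀^{2π} |T′| ≤ (2n/π)·∫₀^{2π} T` (sharp at `1 + cos nθ`); on the line,
`∫|Φ′| ≤ (4a/π)∫Φ` for `0 ≤ Φ ∈ L¹` with spectrum in `[-2a, 2a]` — the inequality that upgrades the frame transfer of
§12.10 (verified RH height ⟹ Weil-positivity window) from `κ = 1` to `κ = 2/π`.  Its proof ends with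
LEMMA Ψ*: at a GLOBAL maximum `ω*` of a real trigonometric polynomial `T` of degree `≤ n`,
`W := T″(ω*) + n·(T̃)′(ω*) ≥ 0`.  Writing `max T − T = sin²(s/2)·E(s)` with `0 ≤ E ∈ 𝒯_{n-1}` (so `E = |h|²` with `h` a
polynomial with `n` coefficients, Fejér–Riesz) and `s_j := ê_j + ê_{-j} = 2·Re ê_j` (`j ≥ 1`), `s_0 := 2ê_0`, one has
`T″(ω*) = ¼·Σ_{m≥1} m²(2s_m − s_{m−1} − s_{m+1})` and `(T̃)′(ω*) = −¼·Σ_{m≥1} m(2s_m − s_{m−1} − s_{m+1})`.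
The finitary content of Lemma Ψ* is kernel-checked here:
* `soloBlind_abel_one`, `soloBlind_abel_two` — summation by parts against `m` and `m²` (the discrete Laplacian of `|m|`
  is `2δ₀`, that of `m²` is `2`), with the exact boundary terms;
* `soloBlind_fejer_sup_le` — Fejér's bound: `‖Σ_k h_k u_k‖² ≤ n·Σ_k‖h_k‖²` whenever `‖u_k‖ ≤ 1` (a trigonometric polynomial
  `|h|²` with `n` coefficients never exceeds `n` times its mean);
* `soloBlind_argSpeed_nonneg` — the assembly: under the coefficient interface to `E = |h|²` (`s_0 = 2Σ‖h_k‖²`, Parseval;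
  `s_0/2 + Σ_{j≥1} s_j = ‖Σ h_k‖²`, the value `E(ω*)`; `s_j = 0` for `j ≥ n`), `W = (n·Σ‖h_k‖² − ‖Σh_k‖²)/2 ≥ 0`.
Everything else in Theorem K (Bauer's reduction to circle-rooted `T`, the first variation on a multiplicity stratum, the
Lagrange functions of `T′`, the conjugate-function integral, Fejér–Riesz) is prose in the report.  Mathlib only; no sorries.
-/

open Finset

namespace Summit.RiemannHypothesis.RiemannHypothesis.Theorems

/-- Abel summation against the weight `m` (`m = i+1`): `Σ_{m=1}^{K} m(2s_m − s_{m−1} − s_{m+1}) = −s_0 + (K+1)s_K − K s_{K+1}`. -/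
theorem soloBlind_abel_one {R : Type*} [CommRing R] (s : ℕ → R) (K : ℕ) :
    ∑ i ∈ range K, ((i : R) + 1) * (2 * s (i + 1) - s i - s (i + 1 + 1))
      = -s 0 + ((K : R) + 1) * s K - (K : R) * s (K + 1) := by
  induction K with
  | zero => simp
  | succ K ih =>
    rw [sum_range_succ]
    push_cast
    linear_combination ih

/-- Abel summation against the weight `m²`:
`Σ_{m=1}^{K} m²(2s_m − s_{m−1} − s_{m+1}) + 2Σ_{m=1}^{K} s_m = −s_0 + (K+1)²s_K − K²s_{K+1}`. -/
theorem soloBlind_abel_two {R : Type*} [CommRing R] (s : ℕ → R) (K : ℕ) :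
    ∑ i ∈ range K, ((i : R) + 1) ^ 2 * (2 * s (i + 1) - s i - s (i + 1 + 1))
        + 2 * ∑ i ∈ range K, s (i + 1)
      = -s 0 + ((K : R) + 1) ^ 2 * s K - (K : R) ^ 2 * s (K + 1) := by
  induction K with
  | zero => simp
  | succ K ih =>
    rw [sum_range_succ, sum_range_succ]
    push_cast
    linear_combination ih

/-- Fejér's bound in coefficient form: `‖Σ_k h_k u_k‖² ≤ n·Σ_k ‖h_k‖²` for `‖u_k‖ ≤ 1`
(take `u_k = e^{ikθ}`: a trigonometric polynomial `|h|²` with `n` coefficients is at most `n` times its mean). -/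
theorem soloBlind_fejer_sup_le {n : ℕ} (h u : Fin n → ℂ) (hu : ∀ k, ‖u k‖ ≤ 1) :
    ‖∑ k, h k * u k‖ ^ 2 ≤ (n : ℝ) * ∑ k, ‖h k‖ ^ 2 := by
  have h1 : ‖∑ k, h k * u k‖ ≤ ∑ k, ‖h k‖ := by
    refine (norm_sum_le _ _).trans (sum_le_sum fun k _ => ?_)
    rw [norm_mul]
    calc ‖h k‖ * ‖u k‖ ≤ ‖h k‖ * 1 := by gcongr; exact hu k
      _ = ‖h k‖ := mul_one _
  have h2 : (∑ k, ‖h k‖) ^ 2 ≤ (n : ℝ) * ∑ k, ‖h k‖ ^ 2 := by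
    have := sq_sum_le_card_mul_sum_sq (s := (univ : Finset (Fin n))) (f := fun k => ‖h k‖)
    simpa using this
  calc ‖∑ k, h k * u k‖ ^ 2 ≤ (∑ k, ‖h k‖) ^ 2 := by gcongr
    _ ≤ (n : ℝ) * ∑ k, ‖h k‖ ^ 2 := h2

/-- LEMMA Ψ* — finitary core.  With `s` the symmetrised coefficients of `E = |h|²` (`h` with `n` coefficients) as in the
module docstring, `W = T″(ω*) + n·(T̃)′(ω*) = ¼Σ m²(…) − (n/4)Σ m(…)` is `≥ 0`; indeed it equals
`(n·Σ‖h_k‖² − ‖Σ h_k‖²)/2`. -/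
theorem soloBlind_argSpeed_nonneg (n : ℕ) (h : Fin n → ℂ) (s : ℕ → ℝ)
    (hsupp : ∀ j, n ≤ j → s j = 0)
    (hparseval : s 0 = 2 * ∑ k, ‖h k‖ ^ 2)
    (heval : s 0 / 2 + ∑ i ∈ range n, s (i + 1) = ‖∑ k, h k‖ ^ 2) :
    0 ≤ (1 / 4 : ℝ) * ∑ i ∈ range n, ((i : ℝ) + 1) ^ 2 * (2 * s (i + 1) - s i - s (i + 1 + 1))
        + (n : ℝ) * (-(1 / 4 : ℝ) * ∑ i ∈ range n, ((i : ℝ) + 1) * (2 * s (i + 1) - s i - s (i + 1 + 1))) := by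
  set P : ℝ := ∑ k, ‖h k‖ ^ 2 with hP
  set Q : ℝ := ‖∑ k, h k‖ ^ 2 with hQ
  have hA := soloBlind_abel_one s n
  have hB := soloBlind_abel_two s n
  have hn0 : s n = 0 := hsupp n le_rfl
  have hn1 : s (n + 1) = 0 := hsupp (n + 1) (Nat.le_succ n)
  rw [hn0, hn1, mul_zero, mul_zero, sub_zero, add_zero] at hA hB
  have hF : Q ≤ (n : ℝ) * P := by
    have := soloBlind_fejer_sup_le h (fun _ => (1 : ℂ)) (fun _ => by simp)
    simpa [hP, hQ] using this
  have e2 : ∑ i ∈ range n, ((i : ℝ) + 1) ^ 2 * (2 * s (i + 1) - s i - s (i + 1 + 1))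
      = -s 0 - 2 * ∑ i ∈ range n, s (i + 1) := by linear_combination hB
  have eS : ∑ i ∈ range n, s (i + 1) = Q - P := by linarith
  rw [hA, e2, eS, hparseval]
  have key : (1 / 4 : ℝ) * (-(2 * P) - 2 * (Q - P)) + (n : ℝ) * (-(1 / 4 : ℝ) * -(2 * P))
      = ((n : ℝ) * P - Q) / 2 := by ring
  rw [key]
  linarith

end Summit.RiemannHypothesis.RiemannHypothesis.Theorems
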